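/-
Copyright (c) 2026. All rights reserved.
Released under Apache 2.0 license as described in the file LICENSE.
-/
import Literature.AlgebraicGeometry.ComplexMultiplication.HyperellipticJacobianSimpleFactorProductsExceptionalClasses
import HarnessLib

/-!
# `E' × E' × Y_{40}` — the SQUARE of the CM elliptic curve `E' = Y_8` (`ℚ(√−2)`) times the simple CM fourfold `Y_{40}` — carries a rational `(3,3)`-class outside `𝓓³`: Moonen–Zarhin's Weil classes `W_k ⊂ H⁶(E² × Y, ℚ)` of case (g), explicit inside `J_{40}`; the TWO-SLOT LIFT of weights

Family `hodge`, cell `pub-hodgecm2` (COR-CM), KEPT Literature lane `lit-deligne-3` (generation 55, file F43; sequel of F42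
`HyperellipticJacobianSimpleFactorProductsExceptionalClasses`).  THEOREMS ONLY: no definition, no named fact, no `sorry`, no instance; D-0026
net debt `0`.  Nothing here asserts the algebraicity of any class; HC_CM is NOT proved.

THE POINT.  F42 descended F40's exceptional weight of `X_{16} × X_{48}` to the simple factors `Y_{16} × Y_{48}` because restriction to the CM fields
`ℚ(ζ − ζ^{−1})` was injective on it, and recorded that F40's weight `{σ_1, σ_3} ⊔ {σ_7, σ_{21}, σ_{23}, σ_{29}}` of `X_8 × X_{40}` does NOT descend to
`E' × Y_{40}`: `σ_1`, `σ_3` are the TWO embeddings of `ℚ(ζ_8)` over ONE embedding of `ℚ(ζ_8 − ζ_8^{−1}) = ℚ(√−2)` (`1 + 3 ≡ 4 (mod 8)`).  That is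
exactly Moonen–Zarhin's mechanism: for their case (g) — `E × Y`, `E` an elliptic curve with CM by `k`, `Y` a simple fourfold with `k ↪ End⁰(Y)`
acting with multiplicities `(1,3)` — «Rather than looking at `E × Y`, let us look at `Z := E² × Y` […] the corresponding space of Weil classes
`W_k ⊂ H⁶(Z, ℚ)` consists of Hodge classes» [corpus: paper:arxiv-math_9901113 p. 10, §5 Case 2], while «`B•(E × Y) = D•(E × Y)`» (Thm. 0.2 (3),
p. 1).  The weight needs BOTH extensions of the `ℚ(√−2)`-embedding, i.e. TWO copies of `H¹(E')`: this file builds the corresponding index map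
(the TWO-SLOT LIFT `Hom(L_0, ℂ) ⊔ Hom(L_0, ℂ) ⊔ Hom(L_1, ℂ) ↪ Hom(K_0, ℂ) ⊔ Hom(K_1, ℂ)`: slot `0 ↦` a chosen extension `σ`, slot `1 ↦ σ ∘ γ` with
`γ : ζ ↦ −ζ^{−1}` the reflection of `ℚ(ζ_8)` over `ℚ(√−2)`, slot `2 ↦` a section through the weight), shows it is injective, pattern-preserving and
covers the weight, and concludes with F42's transport (`diff_nonempty_of_pattern`) and Pohlmann's theorem for the CM algebra `L_0 × L_0 × L_1`
(`exists_exceptional_biproduct_iff`): **`E' ⊕ E' ⊕ Y_{40}` (dimension `1 + 1 + 4 = 6`) carries a rational `(3,3)`-class outside `𝓓³ ⊗ ℂ`**, and so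
does `(E' × E') × Y_{40}`; they are not divisor-generated, not stably nondegenerate.

THE PRINT.  Moonen–Zarhin, Math. Ann. **315** (1999): Introduction (g) and Thm. 0.2 (3) (p. 1), §3 (3.1) (p. 6), §5 (`d_min = 1`, `d_max = 4`,
Case 2; pp. 10–11) — quoted above and in F42.  Shimura (1998) §6.2 Thm. 3, §8.2 Prop. 26 (induced types, `X_d ∼ Y_d^h`); Gallese–Goodson–Lombardo
(2024) §3 Thm. 3.0 (5), §3.3 (`Y_d`, `ℚ(ζ_d − ζ_d^{−1})`, the tree's `exists_isogeny_sq_simple_of_four_dvd`, `eq_fixedField_and_eq_adjoin_of_primitive_of_four_dvd`: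
`γζ = −ζ^{−1}`, `ℚ(ζ_d − ζ_d^{−1}) = ℚ(ζ_d)^γ`, index `2`); Gordon (1999) 9.2.2, §9.3, Thm. 7.6.2; Milne (2020) 1.2 (c); Gao–Ullmo (2025) Thm. 3.1.

WHAT IS PROVED.
* §1 `exists_reflection_of_eq_adjoin` (`γ` with `L = ℚ(ζ_d)^γ`, `γζ_d ≠ ζ_d`, `[ℚ(ζ_d) : L] = 2`, for `L = ℚ(ζ_d − ζ_d^{−1})`, `4 ∣ d ≥ 8`, `d ∉ {20,24,60}`),
  **`eq_or_eq_comp_of_comp_algebraMap_eq`** (the embeddings over one embedding of `L` are `σ`, `σ ∘ γ`).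
* §2 `injOn_restrict_member` (restriction injective on ONE member's part of a weight, certificate form).
* §3 `exists_section_member` (a member-wise section of restriction through a weight), **`exists_embedding_twoSlot`** (the two-slot lift).
* §4 **`exists_simpleFactors_cmCurveSq_fourfold_exceptional_of_lev_eq_eight_forty`** — for realisations `A_0 ⊨ (ℚ(ζ_8); Φ_8)`, `A_1 ⊨ (ℚ(ζ_{40}); Φ_{40})`
  and the simple factors `B_0 = E'` (dim `1`), `B_1 = Y_{40}` (dim `4`) of F42 (`A_i ∼ B_i²`, stably nondegenerate, `Hom = 0` both ways,
  `B_0 × B_1` not stably nondegenerate): an exceptional weight of `(L_0; Ψ_0) ⊔ (L_0; Ψ_0) ⊔ (L_1; Ψ_1)` in degree `3`; a rational `(3,3)`-class outside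
  `𝓓³ ⊗ ℂ` on `B_0 ⊕ B_0 ⊕ B_1` and on `(B_0 × B_0) × B_1` (dimension `6`); neither is divisor-generated nor stably nondegenerate.
* §5 hypothesis-free **`exists_cmCurve_simple_fourfold_cmCurveSq_prod_exceptional`**: ∃ simple `E` (dim `1`), `Y` (dim `4`), both stably
  nondegenerate, `Hom(E, Y) = 0 = Hom(Y, E)`, `E × Y` not stably nondegenerate, `(E × E) × Y` (dim `6`) with a rational `(3,3)`-class outside `𝓓³ ⊗ ℂ`,
  not divisor-generated.

HONEST.  Assembled from tree theorems (F40's weight and certificates, F42's descent and simple factors, the tree's fixed-field ∕ fibre-count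
lemmas) plus the elementary two-slot construction; an explicit instance, inside `J_{40}`, of a configuration Moonen–Zarhin describe in general
(case (g) and §5 Case 2).  NOT typed here: the embedding `k = ℚ(√−2) ↪ End⁰(Y_{40})` with multiplicities `(1,3)`, the identification of the class
with their `W_k`, and `B•(E' × Y_{40}) = D•(E' × Y_{40})` (Thm. 0.2 (3)).  No numerics; no algebraicity claim.

## References
* [MoonenZarhin1999LowDim] B. Moonen, Yu. Zarhin, Math. Ann. 315 (1999) 711–733: Introduction (g), Thm. 0.2 (3), §3 (3.1), §5 (5.9)–(5.11)
  [corpus: paper:arxiv-math_9901113 pp. 1, 6, 10–11]. [cite: MoonenZarhin1999LowDim, Thm. 0.2 (3), §3 (3.1) and §5 (5.9)–(5.11)]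
* [Gordon1999HodgeAVSurvey] B. B. Gordon, *A survey of the Hodge conjecture for abelian varieties*, 7.6.1, Thm. 7.6.2, 9.2.2, §9.3.
  [cite: Gordon1999HodgeAVSurvey, 9.2.2 and Thm. 7.6.2]
* [Shimura1998] G. Shimura (1998), §6.2 Thm. 3, §8.2 Prop. 26. [cite: Shimura1998, §6.2 Thm. 3 and §8.2 Prop. 26]
* [GalleseGoodsonLombardo2024] Gallese–Goodson–Lombardo, §3 Thm. 3.0 (5), §3.3. [cite: GalleseGoodsonLombardo2024, §3 Thm. 3.0 (5) and §3.3]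
* [Milne2020HodgeClassesAV] J. S. Milne, *Hodge classes on abelian varieties* (2020), 1.2 (c). [cite: Milne2020HodgeClassesAV, 1.2 (c)]
* [GaoUllmo2025] Z. Gao, E. Ullmo, Thm. 3.1. [cite: GaoUllmo2025, Thm. 3.1]
* [MumfordAV1970] D. Mumford, *Abelian Varieties*, §19 Thm. 1. [cite: MumfordAV1970, §19 Thm. 1]
* [Washington1997] L. Washington, *Introduction to Cyclotomic Fields*, Thm. 2.5. [cite: Washington1997, Thm. 2.5]
-/

open CategoryTheory CategoryTheory.Limits NumberField Module

namespace Literature.AlgebraicGeometry.ComplexMultiplication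

open Literature.AlgebraicGeometry.Motives
open Literature.AlgebraicGeometry.Motives.AbelianVariety
open Literature.AlgebraicGeometry.HodgeTheory (complexBetti IsRationalClass IsOfHodgeType IsStablyNondegenerate
  IsDivisorGenerated HodgeConjectureFor)
open Literature.AlgebraicGeometry.VanGeemen1994 (hodgeClassSpan)
open Literature.Barriers.HodgeConjecture (divisorClassesSpan)
open Literature.NumberTheory.ComplexMultiplication

namespace HyperellipticJacobian

open Literature.AlgebraicGeometry.Pohlmann1968 Literature.AlgebraicGeometry.Pohlmann1968.Cyclotomic
open Literature.AlgebraicGeometry.Pohlmann1968.CMAlgebra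

/-! ## §1 The reflection `ζ ↦ −ζ^{−1}` fixing `ℚ(ζ_d − ζ_d^{−1})`; the two extensions of an embedding of `ℚ(ζ_d − ζ_d^{−1})` -/

section Reflection

variable {d : ℕ} [NeZero d] {K : Type} [Field K] [NumberField K] [IsCyclotomicExtension {d} ℚ K]

/-- **The reflection of `ℚ(ζ_d)` over `L = ℚ(ζ_d − ζ_d^{−1})`** (`4 ∣ d ≥ 8`, `d ∉ {20, 24, 60}`): an automorphism `γ` (`ζ ↦ −ζ^{−1}`) with
`L = ℚ(ζ_d)^γ`, `ζ_d ∉ L`, `[ℚ(ζ_d) : L] = 2` (the tree's `eq_fixedField_and_eq_adjoin_of_primitive_of_four_dvd` for the primitive sub-pair, whose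
field is the same `ℚ(ζ_d − ζ_d^{−1})`). [cite: GalleseGoodsonLombardo2024, §3 Thm. 3.0 (5) and §3.3] [cite: Shimura1998, §8.2 Prop. 26 (proof)] -/
theorem exists_reflection_of_eq_adjoin (h4 : 4 ∣ d) (h8 : 8 ≤ d) (h20 : d ≠ 20) (h24 : d ≠ 24) (h60 : d ≠ 60)
    {Φ : CMType K} (hΦ : ∀ σ : K →+* ℂ, σ ∈ Φ.1 ↔ 2 * (expOf d K σ).val < d)
    {L : IntermediateField ℚ K} (hL : L = IntermediateField.adjoin ℚ {zetaOf d K - (zetaOf d K)⁻¹}) :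
    ∃ γ : K ≃ₐ[ℚ] K, (∀ x : K, x ∈ L ↔ γ x = x) ∧ γ (zetaOf d K) ≠ zetaOf d K ∧ Module.finrank L K = 2 := by
  obtain ⟨K₁, Φ₁, h₁, hp₁, -⟩ := exists_primitive_inducedCMType_index_two_of_four_dvd h4 h8 h20 h24 h60 Φ hΦ
  obtain ⟨γ, -, -, hfix, hζ, -, hfin, -, hK₁⟩ :=
    eq_fixedField_and_eq_adjoin_of_primitive_of_four_dvd h4 h8 h20 h24 h60 Φ hΦ Φ₁ h₁ hp₁
  have hLK : L = K₁ := hL.trans hK₁.symm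
  subst hLK
  exact ⟨γ, hfix, fun h => hζ ((hfix _).2 h), hfin⟩

variable {L : IntermediateField ℚ K}

/-- `(σ ∘ γ)|_L = σ|_L` for an automorphism `γ` fixing `L` pointwise. [folklore] -/
private theorem comp_comp_algebraMap_eq_of_fix (γ : K ≃ₐ[ℚ] K) (hfix : ∀ x : K, x ∈ L ↔ γ x = x) (σ : K →+* ℂ) :
    (σ.comp (γ : K →+* K)).comp (algebraMap L K) = σ.comp (algebraMap L K) := by
  ext x
  change σ (γ (x : K)) = σ (x : K)
  rw [(hfix (x : K)).1 x.2]

/-- `σ ∘ γ ≠ σ` for `γ ≠ 1` (`σ` is injective). [folklore] -/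
private theorem comp_ne_of_apply_ne (γ : K ≃ₐ[ℚ] K) {z : K} (hz : γ z ≠ z) (σ : K →+* ℂ) : σ.comp (γ : K →+* K) ≠ σ := by
  intro h
  apply hz
  exact σ.injective (by simpa using RingHom.congr_fun h z)

/-- **The two embeddings of `ℚ(ζ_d)` over one embedding of `L`** (`[ℚ(ζ_d) : L] = 2`, `L = ℚ(ζ_d)^γ`): an embedding agreeing with `σ` on
`L` is `σ` or `σ ∘ γ` (the fibre of restriction has `[ℚ(ζ_d) : L] = 2` elements, the tree's `card_filter_comp_algebraMap_eq_finrank`).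
[cite: Shimura1998, §6.2 Thm. 3 (proof) and §8.2 Prop. 26] -/
theorem eq_or_eq_comp_of_comp_algebraMap_eq (γ : K ≃ₐ[ℚ] K) (hfix : ∀ x : K, x ∈ L ↔ γ x = x) {z : K} (hz : γ z ≠ z)
    (hfin : Module.finrank L K = 2) {σ σ' : K →+* ℂ} (h : σ'.comp (algebraMap L K) = σ.comp (algebraMap L K)) :
    σ' = σ ∨ σ' = σ.comp (γ : K →+* K) := by
  classical
  by_contra hne
  push Not at hne
  have hcard := card_filter_comp_algebraMap_eq_finrank (K := K) (K₁ := L) (σ.comp (algebraMap L K))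
  rw [hfin] at hcard
  have hsub : ({σ', σ, σ.comp (γ : K →+* K)} : Finset (K →+* ℂ)) ⊆
      Finset.univ.filter fun ψ : K →+* ℂ => ψ.comp (algebraMap L K) = σ.comp (algebraMap L K) := by
    intro ψ hψ
    simp only [Finset.mem_insert, Finset.mem_singleton] at hψ
    rw [Finset.mem_filter]
    refine ⟨Finset.mem_univ _, ?_⟩
    rcases hψ with rfl | rfl | rfl
    · exact h
    · rfl
    · exact comp_comp_algebraMap_eq_of_fix γ hfix σ
  have h3 : ({σ', σ, σ.comp (γ : K →+* K)} : Finset (K →+* ℂ)).card = 3 := by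
    rw [Finset.card_insert_of_notMem, Finset.card_pair (comp_ne_of_apply_ne γ hz σ).symm]
    simp only [Finset.mem_insert, Finset.mem_singleton, not_or]
    exact hne
  have := Finset.card_le_card hsub
  rw [h3, hcard] at this
  omega

end Reflection

/-! ## §2 Restriction is injective on ONE member's part of a weight, certificate form -/

section OneMember

variable {k : ℕ} {lev : Fin k → ℕ} [∀ i, NeZero (lev i)] {K : Fin k → Type} [∀ i, Field (K i)]
  [∀ i, NumberField (K i)] [∀ i, IsCyclotomicExtension {lev i} ℚ (K i)] {M : ℕ} {L : ∀ i, IntermediateField ℚ (K i)}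

/-- **Restriction to `L_i ∋ ζ_{d_i} − ζ_{d_i}^{−1}` is injective on the points `(i, σ)` of ONE member selected by `P`**, when no two different
exponents `e ≠ e'` selected by `P` have `e + e' ≡ d_i/2 (mod d_i)` (F42 `expOf_eq_or_add_mod_eq_of_apply_eq`).
[cite: GalleseGoodsonLombardo2024, §3.3] [cite: Shimura1998, §8.2 Prop. 26] -/
theorem injOn_restrict_member (i₀ : Fin k) (h2 : 2 ∣ lev i₀) (hζ : zetaOf (lev i₀) (K i₀) - (zetaOf (lev i₀) (K i₀))⁻¹ ∈ L i₀)
    {d₀ : ℕ} [NeZero d₀] (h₀ : lev i₀ = d₀) (P : ZMod M → Prop) [DecidablePred P]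
    (hs : ∀ e e' : ZMod d₀, e.val.Coprime d₀ → e'.val.Coprime d₀ → P ((M / d₀ * e.val : ℕ) : ZMod M) →
      P ((M / d₀ * e'.val : ℕ) : ZMod M) → e ≠ e' → (e.val + e'.val) % d₀ ≠ d₀ / 2) :
    Set.InjOn (fun x : (i : Fin k) × (K i →+* ℂ) =>
        (⟨x.1, x.2.comp (algebraMap (L x.1) (K x.1))⟩ : (i : Fin k) × (L i →+* ℂ)))
      {x | x.1 = i₀ ∧ P ((M / lev x.1 * (expOf (lev x.1) (K x.1) x.2).val : ℕ) : ZMod M)} := by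
  classical
  subst h₀
  rintro ⟨i, σ⟩ ⟨hi, hP⟩ ⟨i', σ'⟩ ⟨hi', hP'⟩ hres
  dsimp only at hi hi' hP hP'
  subst hi
  simp only [Sigma.mk.inj_iff] at hres
  obtain ⟨hii, hheq⟩ := hres
  subst hii
  have hcomp := eq_of_heq hheq
  have happ : σ (zetaOf (lev i) (K i) - (zetaOf (lev i) (K i))⁻¹) = σ' (zetaOf (lev i) (K i) - (zetaOf (lev i) (K i))⁻¹) := by
    have := RingHom.congr_fun hcomp ⟨_, hζ⟩
    simpa using this
  by_cases he : expOf (lev i) (K i) σ' = expOf (lev i) (K i) σ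
  · rw [expOf_injective (lev i) (K i) he]
  · exact absurd ((expOf_eq_or_add_mod_eq_of_apply_eq h2 happ).resolve_left he)
      (hs _ _ (coprime_expOf _ _ σ) (coprime_expOf _ _ σ') hP hP' (fun h => he h.symm))

end OneMember

/-! ## §3 A two-slot lift: both extensions on member `0`, a section through the weight on member `1` -/

section Section

variable {n : ℕ} {K : Fin n → Type} [∀ i, Field (K i)] [∀ i, NumberField (K i)]

/-- **A member-wise section of restriction through a weight**: for a sub-field `L_i ⊆ K_i` and a weight `W` whose member-`i` points have
pairwise different restrictions to `L_i`, a map `s : Hom(L_i, ℂ) → Hom(K_i, ℂ)` with `s(ρ)|_{L_i} = ρ` and `s(σ|_{L_i}) = σ` for `(i, σ) ∈ W`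
(every embedding extends, F42 `exists_comp_algebraMap_eq`). [cite: Shimura1998, §6.2 Thm. 3 (proof)] -/
theorem exists_section_member (L : ∀ i, IntermediateField ℚ (K i)) (i : Fin n) (W : Finset ((i : Fin n) × (K i →+* ℂ)))
    (hinj : ∀ σ σ' : K i →+* ℂ, (⟨i, σ⟩ : (i : Fin n) × (K i →+* ℂ)) ∈ W → (⟨i, σ'⟩ : (i : Fin n) × (K i →+* ℂ)) ∈ W →
      σ.comp (algebraMap (L i) (K i)) = σ'.comp (algebraMap (L i) (K i)) → σ = σ') :
    ∃ s : (L i →+* ℂ) → (K i →+* ℂ), (∀ ρ, (s ρ).comp (algebraMap (L i) (K i)) = ρ) ∧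
      ∀ σ : K i →+* ℂ, (⟨i, σ⟩ : (i : Fin n) × (K i →+* ℂ)) ∈ W → s (σ.comp (algebraMap (L i) (K i))) = σ := by
  classical
  refine ⟨fun ρ => if h : ∃ σ : K i →+* ℂ, (⟨i, σ⟩ : (i : Fin n) × (K i →+* ℂ)) ∈ W ∧ σ.comp (algebraMap (L i) (K i)) = ρ
      then h.choose else (exists_comp_algebraMap_eq L i ρ).choose, fun ρ => ?_, fun σ hσ => ?_⟩
  · by_cases h : ∃ σ : K i →+* ℂ, (⟨i, σ⟩ : (i : Fin n) × (K i →+* ℂ)) ∈ W ∧ σ.comp (algebraMap (L i) (K i)) = ρ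
    · simp only [dif_pos h]; exact h.choose_spec.2
    · simp only [dif_neg h]; exact (exists_comp_algebraMap_eq L i ρ).choose_spec
  · have h : ∃ σ' : K i →+* ℂ, (⟨i, σ'⟩ : (i : Fin n) × (K i →+* ℂ)) ∈ W ∧
        σ'.comp (algebraMap (L i) (K i)) = σ.comp (algebraMap (L i) (K i)) := ⟨σ, hσ, rfl⟩
    simp only [dif_pos h]
    exact hinj _ _ h.choose_spec.1 hσ h.choose_spec.2

end Section

section TwoSlot

variable {K : Fin 2 → Type} [∀ i, Field (K i)] [∀ i, NumberField (K i)] {L : ∀ i, IntermediateField ℚ (K i)}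

/-- **THE TWO-SLOT LIFT.**  For sub-fields `L_i ⊆ K_i` (`i = 0, 1`), automorphisms `γ_i` of `K_i` fixing `L_i` pointwise such that the embeddings
of `K_0` over one embedding of `L_0` are exactly `σ, σ ∘ γ_0` (`σ ∘ γ_0 ≠ σ`), and a weight `W ⊆ Hom(K_0, ℂ) ⊔ Hom(K_1, ℂ)` whose member-`1` points
have pairwise different restrictions to `L_1`: there is an injection `f : Hom(L_0, ℂ) ⊔ Hom(L_0, ℂ) ⊔ Hom(L_1, ℂ) ↪ Hom(K_0, ℂ) ⊔ Hom(K_1, ℂ)` over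
restriction (slot `0 ↦` a chosen extension `σ`, slot `1 ↦ σ ∘ γ_0`, slot `2 ↦` a section through `W`) whose range contains `W`.  This is the index
map of the decomposition `H¹(X_8) ⊕ H¹(X_{40}) ⊇ H¹(E')^{⊕2} ⊕ H¹(Y_{40})` (`X_8 ∼ E'²`, `X_{40} ∼ Y_{40}²`). [cite: Shimura1998, §6.2 Thm. 3]
[cite: MoonenZarhin1999LowDim, §5 (Case 2: «Z := E² × Y»)] -/
theorem exists_embedding_twoSlot (γ : ∀ i, K i ≃ₐ[ℚ] K i) (hfix : ∀ i (x : K i), x ∈ L i ↔ γ i x = x)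
    (htwo : ∀ σ σ' : K 0 →+* ℂ, σ'.comp (algebraMap (L 0) (K 0)) = σ.comp (algebraMap (L 0) (K 0)) →
      σ' = σ ∨ σ' = σ.comp (γ 0 : K 0 →+* K 0))
    (hne : ∀ σ : K 0 →+* ℂ, σ.comp (γ 0 : K 0 →+* K 0) ≠ σ) (W : Finset ((i : Fin 2) × (K i →+* ℂ)))
    (hinj : ∀ σ σ' : K 1 →+* ℂ, (⟨1, σ⟩ : (i : Fin 2) × (K i →+* ℂ)) ∈ W → (⟨1, σ'⟩ : (i : Fin 2) × (K i →+* ℂ)) ∈ W →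
      σ.comp (algebraMap (L 1) (K 1)) = σ'.comp (algebraMap (L 1) (K 1)) → σ = σ') :
    ∃ f : ((j : Fin 3) × (L ((![0, 0, 1] : Fin 3 → Fin 2) j) →+* ℂ)) ↪ ((i : Fin 2) × (K i →+* ℂ)),
      (∀ y, (⟨(f y).1, (f y).2.comp (algebraMap (L (f y).1) (K (f y).1))⟩ : (i : Fin 2) × (L i →+* ℂ)) =
        ⟨(![0, 0, 1] : Fin 3 → Fin 2) y.1, y.2⟩) ∧
      ∀ x ∈ W, x ∈ Set.range f := by
  classical
  have hinj' : ∀ (i : Fin 2) (σ σ' : K i →+* ℂ), (⟨i, σ⟩ : (i : Fin 2) × (K i →+* ℂ)) ∈ W.filter (fun x => x.1 = 1) →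
      (⟨i, σ'⟩ : (i : Fin 2) × (K i →+* ℂ)) ∈ W.filter (fun x => x.1 = 1) →
      σ.comp (algebraMap (L i) (K i)) = σ'.comp (algebraMap (L i) (K i)) → σ = σ' := by
    refine Fin.forall_fin_two.2 ⟨fun σ σ' h _ _ => ?_, fun σ σ' h h' he => ?_⟩
    · exact (Fin.zero_ne_one (Finset.mem_filter.1 h).2).elim
    · exact hinj σ σ' (Finset.mem_filter.1 h).1 (Finset.mem_filter.1 h').1 he
  choose S hS hSW using fun i => exists_section_member L i (W.filter fun x => x.1 = 1) (hinj' i)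
  let c : Fin 3 → Fin 2 := ![0, 0, 1]
  let g : ((j : Fin 3) × (L (c j) →+* ℂ)) → ((i : Fin 2) × (K i →+* ℂ)) := fun y =>
    ⟨c y.1, if y.1 = 1 then (S (c y.1) y.2).comp (γ (c y.1) : K (c y.1) →+* K (c y.1)) else S (c y.1) y.2⟩
  have hg0 : ∀ ρ : L 0 →+* ℂ, g ⟨0, ρ⟩ = ⟨0, S 0 ρ⟩ := fun ρ => by
    simp only [g, c, show ¬((0 : Fin 3) = 1) by decide, if_false]; rfl
  have hg1 : ∀ ρ : L 0 →+* ℂ, g ⟨1, ρ⟩ = ⟨0, (S 0 ρ).comp (γ 0 : K 0 →+* K 0)⟩ := fun ρ => by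
    simp only [g, c, if_true]; rfl
  have hg2 : ∀ ρ : L 1 →+* ℂ, g ⟨2, ρ⟩ = ⟨1, S 1 ρ⟩ := fun ρ => by
    simp only [g, c, show ¬((2 : Fin 3) = 1) by decide, if_false]; rfl
  -- restriction property
  have hgr : ∀ y, (⟨(g y).1, (g y).2.comp (algebraMap (L (g y).1) (K (g y).1))⟩ : (i : Fin 2) × (L i →+* ℂ)) = ⟨c y.1, y.2⟩ := by
    rintro ⟨j, ρ⟩
    by_cases hj : j = 1
    · simp only [g, hj, if_true]
      rw [comp_comp_algebraMap_eq_of_fix (γ _) (hfix _), hS]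
    · simp only [g, hj, if_false]
      rw [hS]
  -- injectivity
  have hne01 : ∀ ρ ρ' : L 0 →+* ℂ, g ⟨0, ρ⟩ ≠ g ⟨1, ρ'⟩ := by
    intro ρ ρ' h
    have hρ : ρ = ρ' := by
      have h' := (hgr ⟨0, ρ⟩).symm.trans ((congrArg (fun x : (i : Fin 2) × (K i →+* ℂ) =>
        (⟨x.1, x.2.comp (algebraMap (L x.1) (K x.1))⟩ : (i : Fin 2) × (L i →+* ℂ))) h).trans (hgr ⟨1, ρ'⟩))
      exact eq_of_heq (Sigma.mk.inj_iff.1 h').2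
    subst hρ
    rw [hg0, hg1] at h
    exact hne (S 0 ρ) (eq_of_heq (Sigma.mk.inj_iff.1 h).2).symm
  have hginj : Function.Injective g := by
    rintro ⟨j, ρ⟩ ⟨j', ρ'⟩ h
    have h' := (hgr ⟨j, ρ⟩).symm.trans ((congrArg (fun x : (i : Fin 2) × (K i →+* ℂ) =>
      (⟨x.1, x.2.comp (algebraMap (L x.1) (K x.1))⟩ : (i : Fin 2) × (L i →+* ℂ))) h).trans (hgr ⟨j', ρ'⟩))
    obtain ⟨hc, hρ⟩ := Sigma.mk.inj_iff.1 h'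
    have h02 : (![0, 0, 1] : Fin 3 → Fin 2) 0 ≠ (![0, 0, 1] : Fin 3 → Fin 2) 2 := by decide
    have h12 : (![0, 0, 1] : Fin 3 → Fin 2) 1 ≠ (![0, 0, 1] : Fin 3 → Fin 2) 2 := by decide
    fin_cases j <;> fin_cases j'
    · cases eq_of_heq hρ; rfl
    · exact absurd h (hne01 ρ ρ')
    · exact absurd hc h02
    · exact absurd h.symm (hne01 ρ' ρ)
    · cases eq_of_heq hρ; rfl
    · exact absurd hc h12
    · exact absurd hc h02.symm
    · exact absurd hc h12.symm
    · cases eq_of_heq hρ; rfl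
  refine ⟨⟨g, hginj⟩, fun y => hgr y, ?_⟩
  -- the range contains `W`: a member-`0` point `σ` is `S_0(σ|) ` (slot `0`) or `S_0(σ|) ∘ γ_0` (slot `1`); a member-`1` point is `S_1(σ|)`
  suffices hW : ∀ (i : Fin 2) (σ : K i →+* ℂ), (⟨i, σ⟩ : (i : Fin 2) × (K i →+* ℂ)) ∈ W →
      (⟨i, σ⟩ : (i : Fin 2) × (K i →+* ℂ)) ∈ Set.range g by
    rintro ⟨i, σ⟩ hx
    exact hW i σ hx
  refine Fin.forall_fin_two.2 ⟨fun σ hx => ?_, fun σ hx => ?_⟩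
  · rcases htwo (S 0 (σ.comp (algebraMap (L 0) (K 0)))) σ (by rw [hS]) with h | h
    · exact ⟨⟨0, σ.comp (algebraMap (L 0) (K 0))⟩, by rw [hg0]; exact congrArg (Sigma.mk (0 : Fin 2)) h.symm⟩
    · exact ⟨⟨1, σ.comp (algebraMap (L 0) (K 0))⟩, by rw [hg1]; exact congrArg (Sigma.mk (0 : Fin 2)) h.symm⟩
  · have hx1 : (⟨1, σ⟩ : (i : Fin 2) × (K i →+* ℂ)) ∈ W.filter fun x => x.1 = 1 := Finset.mem_filter.2 ⟨hx, rfl⟩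
    exact ⟨⟨2, σ.comp (algebraMap (L 1) (K 1))⟩, by rw [hg2]; exact congrArg (Sigma.mk (1 : Fin 2)) (hSW 1 σ hx1)⟩

end TwoSlot

/-! ## §4 `E' ⊕ E' ⊕ Y_{40}`: Moonen–Zarhin's Weil classes `W_k ⊂ H⁶(E² × Y, ℚ)` made explicit — a rational `(3,3)`-class outside `𝓓³` -/

section EightForty

/-- The residue certificate for the level-`40` part of F40's weight: no two DIFFERENT exponents among `7, 21, 23, 29` sum to `20 (mod 40)`
(sums `28, 30, 36, 44, 50, 52`). [folklore] -/
private theorem cert_forty : ∀ e e' : ZMod 40, e.val.Coprime 40 → e'.val.Coprime 40 →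
    (((40 / 40 * e.val : ℕ) : ZMod 40).val = 7 ∨ ((40 / 40 * e.val : ℕ) : ZMod 40).val = 21 ∨
      ((40 / 40 * e.val : ℕ) : ZMod 40).val = 23 ∨ ((40 / 40 * e.val : ℕ) : ZMod 40).val = 29) →
    (((40 / 40 * e'.val : ℕ) : ZMod 40).val = 7 ∨ ((40 / 40 * e'.val : ℕ) : ZMod 40).val = 21 ∨
      ((40 / 40 * e'.val : ℕ) : ZMod 40).val = 23 ∨ ((40 / 40 * e'.val : ℕ) : ZMod 40).val = 29) →
    e ≠ e' → (e.val + e'.val) % 40 ≠ 40 / 2 := by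
  have key : ∀ a ∈ ({7, 21, 23, 29} : Finset ℕ), ∀ b ∈ ({7, 21, 23, 29} : Finset ℕ), a ≠ b → (a + b) % 40 ≠ 40 / 2 := by decide
  have hlift : ∀ e : ZMod 40, ((40 / 40 * e.val : ℕ) : ZMod 40).val = e.val := fun e => by
    rw [ZMod.val_natCast, Nat.div_self (by norm_num), one_mul, Nat.mod_eq_of_lt (ZMod.val_lt e)]
  intro e e' _ _ hP hP' hne
  rw [hlift] at hP
  rw [hlift] at hP'
  have hmem : ∀ a : ℕ, (a = 7 ∨ a = 21 ∨ a = 23 ∨ a = 29) → a ∈ ({7, 21, 23, 29} : Finset ℕ) := fun a ha => by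
    simp only [Finset.mem_insert, Finset.mem_singleton]; exact ha
  exact key _ (hmem _ hP) _ (hmem _ hP') (fun h => hne (ZMod.val_injective 40 h))

/-- `⨁_{j : Fin 3} P j` is a retract of `((P 0 × P 1) × P 2)` and conversely; exceptional classes and failure of `B = D` ∕ (D) pass to the
iterated product. [cite: Gordon1999HodgeAVSurvey, 7.6.1] -/
private theorem prod3_of_biproduct_three (P : Fin 3 → AbelianVariety ℂ) :
    (IsStablyNondegenerate (((P 0).prod (P 1)).prod (P 2)) → IsStablyNondegenerate (⨁ P)) ∧
    (IsDivisorGenerated (((P 0).prod (P 1)).prod (P 2)) → IsDivisorGenerated (⨁ P)) ∧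
    ∀ {p : ℕ}, (∃ c : complexBetti (⨁ P).X (2 * p), IsRationalClass c ∧ IsOfHodgeType (⨁ P).dim (⨁ P).X (2 * p) p p c ∧
        c ∉ divisorClassesSpan (⨁ P).X (⨁ P).dim p) →
      ∃ c : complexBetti (((P 0).prod (P 1)).prod (P 2)).X (2 * p), IsRationalClass c ∧
        IsOfHodgeType (((P 0).prod (P 1)).prod (P 2)).dim (((P 0).prod (P 1)).prod (P 2)).X (2 * p) p p c ∧
        c ∉ divisorClassesSpan (((P 0).prod (P 1)).prod (P 2)).X (((P 0).prod (P 1)).prod (P 2)).dim p := by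
  let t : (⨁ P) ⟶ ((P 0).prod (P 1)).prod (P 2) :=
    AbelianVariety.prodLift (AbelianVariety.prodLift (biproduct.π P 0) (biproduct.π P 1)) (biproduct.π P 2)
  let r : ((P 0).prod (P 1)).prod (P 2) ⟶ ⨁ P :=
    AbelianVariety.fst _ _ ≫ AbelianVariety.fst _ _ ≫ biproduct.ι P 0 + AbelianVariety.fst _ _ ≫ AbelianVariety.snd _ _ ≫ biproduct.ι P 1 +
      AbelianVariety.snd _ _ ≫ biproduct.ι P 2
  have htr : t ≫ r = (1 : ℕ) • 𝟙 (⨁ P) := by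
    rw [one_smul]
    simp only [t, r, Preadditive.comp_add, ← Category.assoc, AbelianVariety.prodLift_fst, AbelianVariety.prodLift_snd]
    have htot := biproduct.total (f := P)
    rw [Fin.sum_univ_three] at htot
    exact htot
  exact ⟨HodgeTheory.IsStablyNondegenerate.of_comp_eq_nsmul_id t r one_ne_zero htr,
    HodgeTheory.IsDivisorGenerated.of_comp_eq_nsmul_id t r one_ne_zero htr,
    fun hc => exists_exceptional_of_comp_eq_nsmul_id t r one_ne_zero htr hc⟩

variable {lev : Fin 2 → ℕ} [∀ i, NeZero (lev i)] {K : Fin 2 → Type} [∀ i, Field (K i)] [∀ i, NumberField (K i)]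
  [∀ i, IsCyclotomicExtension {lev i} ℚ (K i)] {Φ : ∀ i, CMType (K i)} {A : Fin 2 → AbelianVariety ℂ}
  {ι : ∀ i, 𝓞 (K i) →+* End (A i)} {θ : ∀ i, K i →+* Module.End ℂ (complexBetti (A i).X 1)}

/-- **`E' ⊕ E' ⊕ Y_{40}` CARRIES A RATIONAL `(3,3)`-CLASS OUTSIDE `𝓓³ ⊗ ℂ`** (dimension `6`).  For realisations `A_0 ⊨ (ℚ(ζ_8); Φ_8)`,
`A_1 ⊨ (ℚ(ζ_{40}); Φ_{40})` of the lower-half types and the simple factors `E' = B_0` (a CM elliptic curve, `ℚ(ζ_8 − ζ_8^{−1}) = ℚ(√−2)`),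
`Y_{40} = B_1` (a simple CM fourfold) of F42 (`A_i ∼ B_i²`, both stably nondegenerate, `Hom = 0` both ways): F40's exceptional weight
`{σ_1, σ_3} ⊔ {σ_7, σ_{21}, σ_{23}, σ_{29}}` of `X_8 × X_{40}` is the image of a weight of the CM algebra `L_0 × L_0 × L_1` under the TWO-SLOT LIFT
(`σ_1, σ_3` are the two extensions of the single embedding of `ℚ(√−2)` they restrict to — `1 + 3 ≡ 4 (mod 8)`; the level-`40` points have pairwise
different restrictions — `a + b ≢ 20 (mod 40)` on `{7, 21, 23, 29}`), hence a balanced non-divisorial `6`-subset of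
`Hom(L_0, ℂ) ⊔ Hom(L_0, ℂ) ⊔ Hom(L_1, ℂ)`: the biproduct `B_0 ⊕ B_0 ⊕ B_1` and the product `(B_0 × B_0) × B_1` carry a rational `(3,3)`-class
outside `𝓓³ ⊗ ℂ`, are not divisor-generated, not stably nondegenerate — Moonen–Zarhin's «`Z := E² × Y` […] `W_k ⊂ H⁶(Z, ℚ)` consists of Hodge
classes» for their case (g), explicit inside `J_{40}`. [cite: MoonenZarhin1999LowDim, Thm. 0.2 (3), §3 (3.1) and §5 (5.9)–(5.11), Case 2]
[cite: Gordon1999HodgeAVSurvey, 9.2.2, §9.3 and Thm. 7.6.2] [cite: Shimura1998, §6.2 Thm. 3 and §8.2 Prop. 26] [cite: GalleseGoodsonLombardo2024, §3 Thm. 3.0 (5)]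
[cite: GaoUllmo2025, Thm. 3.1] -/
theorem exists_simpleFactors_cmCurveSq_fourfold_exceptional_of_lev_eq_eight_forty (h0 : lev 0 = 8) (h1 : lev 1 = 40)
    (hΦ : ∀ i (σ : K i →+* ℂ), σ ∈ (Φ i).1 ↔ 2 * (expOf (lev i) (K i) σ).val < lev i)
    (hA : ∀ i, IsCMTypeRealisation (Φ i) (A i) (ι i) (θ i)) :
    ∃ (L : ∀ i, IntermediateField ℚ (K i)) (Ψ : ∀ i, CMType (L i)) (B : Fin 2 → AbelianVariety ℂ)
      (ιB : ∀ i, 𝓞 (L i) →+* End (B i)) (θB : ∀ i, L i →+* Module.End ℂ (complexBetti (B i).X 1)),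
      (∀ i, inducedCMType (algebraMap (L i) (K i)) (Ψ i) = Φ i) ∧
      (∀ i, L i = IntermediateField.adjoin ℚ {zetaOf (lev i) (K i) - (zetaOf (lev i) (K i))⁻¹}) ∧
      (∀ i, IsCMTypeRealisation (Ψ i) (B i) (ιB i) (θB i)) ∧ (∀ i, (B i).IsSimple) ∧
      (∀ i, IsIsogenous (A i) (⨁ fun _ : Fin 2 => B i)) ∧
      (B 0).dim = 1 ∧ (B 1).dim = 4 ∧ IsStablyNondegenerate (B 0) ∧ IsStablyNondegenerate (B 1) ∧
      (∀ u : B 0 ⟶ B 1, u = 0) ∧ (∀ v : B 1 ⟶ B 0, v = 0) ∧ ¬IsStablyNondegenerate ((B 0).prod (B 1)) ∧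
      (pohlmannSetsAlg (fun j : Fin 3 => Ψ ((![0, 0, 1] : Fin 3 → Fin 2) j)) 3 \
        pohlmannDivisorSetsAlg (fun j : Fin 3 => Ψ ((![0, 0, 1] : Fin 3 → Fin 2) j)) 3).Nonempty ∧
      (⨁ fun j : Fin 3 => B ((![0, 0, 1] : Fin 3 → Fin 2) j)).dim = 6 ∧
      (∃ c : complexBetti (⨁ fun j : Fin 3 => B ((![0, 0, 1] : Fin 3 → Fin 2) j)).X (2 * 3), IsRationalClass c ∧
        IsOfHodgeType (⨁ fun j : Fin 3 => B ((![0, 0, 1] : Fin 3 → Fin 2) j)).dim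
          (⨁ fun j : Fin 3 => B ((![0, 0, 1] : Fin 3 → Fin 2) j)).X (2 * 3) 3 3 c ∧
        c ∉ divisorClassesSpan (⨁ fun j : Fin 3 => B ((![0, 0, 1] : Fin 3 → Fin 2) j)).X
          (⨁ fun j : Fin 3 => B ((![0, 0, 1] : Fin 3 → Fin 2) j)).dim 3) ∧
      ¬IsDivisorGenerated (⨁ fun j : Fin 3 => B ((![0, 0, 1] : Fin 3 → Fin 2) j)) ∧
      (((B 0).prod (B 0)).prod (B 1)).dim = 6 ∧
      (∃ c : complexBetti (((B 0).prod (B 0)).prod (B 1)).X (2 * 3), IsRationalClass c ∧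
        IsOfHodgeType (((B 0).prod (B 0)).prod (B 1)).dim (((B 0).prod (B 0)).prod (B 1)).X (2 * 3) 3 3 c ∧
        c ∉ divisorClassesSpan (((B 0).prod (B 0)).prod (B 1)).X (((B 0).prod (B 0)).prod (B 1)).dim 3) ∧
      ¬IsDivisorGenerated (((B 0).prod (B 0)).prod (B 1)) ∧ ¬IsStablyNondegenerate (((B 0).prod (B 0)).prod (B 1)) := by
  classical
  obtain ⟨L, Ψ, B, ιB, θB, hind, hfin, hL, hB, hs, hiso, hd0, hd1, hB0, hB1, hu, hv, -, hnot⟩ :=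
    exists_simpleFactors_of_lev_eq_eight_forty (lev := lev) (A := A) h0 h1 hΦ hA
  -- the reflections `γ_i` of `ℚ(ζ_{d_i})` over `L_i = ℚ(ζ − ζ^{−1})`
  have hdata : ∀ i : Fin 2, 4 ∣ lev i ∧ 8 ≤ lev i ∧ lev i ≠ 20 ∧ lev i ≠ 24 ∧ lev i ≠ 60 ∧ 2 ∣ lev i ∧ lev i ∣ 40 := by
    refine Fin.forall_fin_two.2 ⟨?_, ?_⟩
    · rw [h0]; norm_num
    · rw [h1]; norm_num
  choose γ hγfix hγz hγfin using fun i => exists_reflection_of_eq_adjoin (hdata i).1 (hdata i).2.1 (hdata i).2.2.1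
    (hdata i).2.2.2.1 (hdata i).2.2.2.2.1 (hΦ i) (hL i)
  -- F40's weight and the injectivity of restriction on its level-`40` part
  have hW := weightForty_mem_pohlmannSetsAlg_diff (lev := lev) (K := K) (Φ := Φ) (fun i => (hdata i).2.2.2.2.2.2) (i₁ := 0) (i₂ := 1)
    h0 h1 hΦ
  have hζ1 : zetaOf (lev 1) (K 1) - (zetaOf (lev 1) (K 1))⁻¹ ∈ L 1 := by
    rw [hL 1]; exact IntermediateField.subset_adjoin ℚ _ (Set.mem_singleton _)
  have hinj1 := injOn_restrict_member (lev := lev) (K := K) (M := 40) (L := L) 1 (hdata 1).2.2.2.2.2.1 hζ1 h1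
    (fun t : ZMod 40 => t.val = 7 ∨ t.val = 21 ∨ t.val = 23 ∨ t.val = 29) cert_forty
  have hinj : ∀ σ σ' : K 1 →+* ℂ,
      (⟨1, σ⟩ : (i : Fin 2) × (K i →+* ℂ)) ∈ (Finset.univ.filter fun x : (i : Fin 2) × (K i →+* ℂ) =>
        (x.1 = 0 ∧ ((((40 / lev x.1 * (expOf (lev x.1) (K x.1) x.2).val : ℕ) : ZMod 40)).val = 5 ∨
          (((40 / lev x.1 * (expOf (lev x.1) (K x.1) x.2).val : ℕ) : ZMod 40)).val = 15)) ∨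
        (x.1 = 1 ∧ ((((40 / lev x.1 * (expOf (lev x.1) (K x.1) x.2).val : ℕ) : ZMod 40)).val = 7 ∨
          (((40 / lev x.1 * (expOf (lev x.1) (K x.1) x.2).val : ℕ) : ZMod 40)).val = 21 ∨
          (((40 / lev x.1 * (expOf (lev x.1) (K x.1) x.2).val : ℕ) : ZMod 40)).val = 23 ∨
          (((40 / lev x.1 * (expOf (lev x.1) (K x.1) x.2).val : ℕ) : ZMod 40)).val = 29))) →
      (⟨1, σ'⟩ : (i : Fin 2) × (K i →+* ℂ)) ∈ (Finset.univ.filter fun x : (i : Fin 2) × (K i →+* ℂ) =>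
        (x.1 = 0 ∧ ((((40 / lev x.1 * (expOf (lev x.1) (K x.1) x.2).val : ℕ) : ZMod 40)).val = 5 ∨
          (((40 / lev x.1 * (expOf (lev x.1) (K x.1) x.2).val : ℕ) : ZMod 40)).val = 15)) ∨
        (x.1 = 1 ∧ ((((40 / lev x.1 * (expOf (lev x.1) (K x.1) x.2).val : ℕ) : ZMod 40)).val = 7 ∨
          (((40 / lev x.1 * (expOf (lev x.1) (K x.1) x.2).val : ℕ) : ZMod 40)).val = 21 ∨
          (((40 / lev x.1 * (expOf (lev x.1) (K x.1) x.2).val : ℕ) : ZMod 40)).val = 23 ∨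
          (((40 / lev x.1 * (expOf (lev x.1) (K x.1) x.2).val : ℕ) : ZMod 40)).val = 29))) →
      σ.comp (algebraMap (L 1) (K 1)) = σ'.comp (algebraMap (L 1) (K 1)) → σ = σ' := by
    intro σ σ' hσ hσ' he
    have mem : ∀ τ : K 1 →+* ℂ, (⟨1, τ⟩ : (i : Fin 2) × (K i →+* ℂ)) ∈ (Finset.univ.filter fun x : (i : Fin 2) × (K i →+* ℂ) =>
        (x.1 = 0 ∧ ((((40 / lev x.1 * (expOf (lev x.1) (K x.1) x.2).val : ℕ) : ZMod 40)).val = 5 ∨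
          (((40 / lev x.1 * (expOf (lev x.1) (K x.1) x.2).val : ℕ) : ZMod 40)).val = 15)) ∨
        (x.1 = 1 ∧ ((((40 / lev x.1 * (expOf (lev x.1) (K x.1) x.2).val : ℕ) : ZMod 40)).val = 7 ∨
          (((40 / lev x.1 * (expOf (lev x.1) (K x.1) x.2).val : ℕ) : ZMod 40)).val = 21 ∨
          (((40 / lev x.1 * (expOf (lev x.1) (K x.1) x.2).val : ℕ) : ZMod 40)).val = 23 ∨
          (((40 / lev x.1 * (expOf (lev x.1) (K x.1) x.2).val : ℕ) : ZMod 40)).val = 29))) →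
        (⟨1, τ⟩ : (i : Fin 2) × (K i →+* ℂ)) ∈ {x : (i : Fin 2) × (K i →+* ℂ) | x.1 = 1 ∧
          ((((40 / lev x.1 * (expOf (lev x.1) (K x.1) x.2).val : ℕ) : ZMod 40)).val = 7 ∨
          (((40 / lev x.1 * (expOf (lev x.1) (K x.1) x.2).val : ℕ) : ZMod 40)).val = 21 ∨
          (((40 / lev x.1 * (expOf (lev x.1) (K x.1) x.2).val : ℕ) : ZMod 40)).val = 23 ∨
          (((40 / lev x.1 * (expOf (lev x.1) (K x.1) x.2).val : ℕ) : ZMod 40)).val = 29)} := by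
      intro τ hτ
      rcases (Finset.mem_filter.1 hτ).2 with ⟨h10, -⟩ | ⟨-, hP⟩
      · exact (Fin.zero_ne_one h10.symm).elim
      · exact ⟨rfl, hP⟩
    have h := hinj1 (mem σ hσ) (mem σ' hσ') (by simp only [he])
    exact eq_of_heq (Sigma.mk.inj_iff.1 h).2
  -- the two-slot lift and the descent
  obtain ⟨f, hf, hrange⟩ := exists_embedding_twoSlot (L := L) γ hγfix
    (fun σ σ' h => eq_or_eq_comp_of_comp_algebraMap_eq (γ 0) (hγfix 0) (hγz 0) (hγfin 0) h)
    (fun σ => comp_ne_of_apply_ne (γ 0) (hγz 0) σ) _ hinj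
  have hpat : ∀ (τ : ℂ ≃+* ℂ) (y : (j : Fin 3) × (L ((![0, 0, 1] : Fin 3 → Fin 2) j) →+* ℂ)),
      (τ : ℂ →+* ℂ).comp (f y).2 ∈ (Φ (f y).1).1 ↔
        (τ : ℂ →+* ℂ).comp y.2 ∈ ((fun j : Fin 3 => Ψ ((![0, 0, 1] : Fin 3 → Fin 2) j)) y.1).1 :=
    fun τ y => comp_mem_iff_of_restrict_eq hind τ (f y) (hf y)
  have hne := diff_nonempty_of_pattern (Ψ := fun j : Fin 3 => Ψ ((![0, 0, 1] : Fin 3 → Fin 2) j)) f hpat hW hrange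
  have hB' : ∀ j : Fin 3, IsCMTypeRealisation (Ψ ((![0, 0, 1] : Fin 3 → Fin 2) j)) (B ((![0, 0, 1] : Fin 3 → Fin 2) j))
      (ιB ((![0, 0, 1] : Fin 3 → Fin 2) j)) (θB ((![0, 0, 1] : Fin 3 → Fin 2) j)) := fun j => hB _
  obtain ⟨c, hcQ, hcH, hcD⟩ :=
    (exists_exceptional_biproduct_iff (K := fun j : Fin 3 => ↥(L ((![0, 0, 1] : Fin 3 → Fin 2) j))) hB' 3).2 hne
  have hnotD : ¬IsDivisorGenerated (⨁ fun j : Fin 3 => B ((![0, 0, 1] : Fin 3 → Fin 2) j)) := fun hD => hcD (hD 3 c hcQ hcH)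
  have hdim6 : (⨁ fun j : Fin 3 => B ((![0, 0, 1] : Fin 3 → Fin 2) j)).dim = 6 := by
    rw [dim_biproduct, Fin.sum_univ_three]
    change (B 0).dim + (B 0).dim + (B 1).dim = 6
    omega
  -- the iterated product `(E' × E') × Y_{40}`
  obtain ⟨hPS, hPD, hPc⟩ := prod3_of_biproduct_three (fun j : Fin 3 => B ((![0, 0, 1] : Fin 3 → Fin 2) j))
  have hcP := hPc ⟨c, hcQ, hcH, hcD⟩
  have hdimP : (((B 0).prod (B 0)).prod (B 1)).dim = 6 := by rw [AbelianVariety.dim_prod, AbelianVariety.dim_prod, hd0, hd1]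
  refine ⟨L, Ψ, B, ιB, θB, hind, hL, hB, hs, hiso, hd0, hd1, hB0, hB1, hu, hv, hnot, hne, hdim6, ⟨c, hcQ, hcH, hcD⟩, hnotD, hdimP,
    hcP, fun hD => hnotD (hPD hD), fun hS => ?_⟩
  exact not_isStablyNondegenerate_of_exists_exceptional hcQ hcH hcD (hPS hS)

end EightForty

/-! ## §5 Hypothesis-free -/

section Existence

/-- **MOONEN–ZARHIN'S CASE (g) WITH ITS WEIL CLASSES, EXPLICIT**: there are a CM elliptic curve `E` (complex multiplication by `ℚ(√−2)`) and a SIMPLE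
abelian fourfold `Y` (complex multiplication by `ℚ(ζ_{40} − ζ_{40}^{−1})`), both stably nondegenerate, `Hom(E, Y) = 0 = Hom(Y, E)`, such that
`E × Y` (dimension `5`) is not stably nondegenerate and `(E × E) × Y` (dimension `6`) carries a rational `(3,3)`-class outside `𝓓³ ⊗ ℂ` — it is not
divisor-generated.  (`E = Y_8`, `Y = Y_{40}`, the simple factors of `X_8 × X_{40} ⊂ J_{40}`.) [cite: MoonenZarhin1999LowDim, Thm. 0.2 (3), §3 (3.1) and §5 (5.9)–(5.11), Case 2]
[cite: Gordon1999HodgeAVSurvey, Thm. 7.6.2 and the remark following it] [cite: Shimura1998, §6.2 Thm. 3 and §8.2 Prop. 26] -/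
theorem exists_cmCurve_simple_fourfold_cmCurveSq_prod_exceptional :
    ∃ E Y : AbelianVariety ℂ, E.IsSimple ∧ Y.IsSimple ∧ E.dim = 1 ∧ Y.dim = 4 ∧
      IsStablyNondegenerate E ∧ IsStablyNondegenerate Y ∧ (∀ u : E ⟶ Y, u = 0) ∧ (∀ v : Y ⟶ E, v = 0) ∧
      ¬IsStablyNondegenerate (E.prod Y) ∧ ((E.prod E).prod Y).dim = 6 ∧
      (∃ c : complexBetti ((E.prod E).prod Y).X (2 * 3), IsRationalClass c ∧
        IsOfHodgeType ((E.prod E).prod Y).dim ((E.prod E).prod Y).X (2 * 3) 3 3 c ∧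
        c ∉ divisorClassesSpan ((E.prod E).prod Y).X ((E.prod E).prod Y).dim 3) ∧
      ¬IsDivisorGenerated ((E.prod E).prod Y) := by
  obtain ⟨K, _, _, _, _, Φ, A, ι, θ, hΦ, hA⟩ := exists_realisation_family (![8, 40] : Fin 2 → ℕ)
    (fun i => by fin_cases i <;> decide) (fun i => by fin_cases i <;> decide)
  obtain ⟨L, Ψ, B, ιB, θB, -, -, -, hs, -, hd0, hd1, hB0, hB1, hu, hv, hnot, -, -, -, -, hdimP, hcP, hDP, -⟩ :=
    exists_simpleFactors_cmCurveSq_fourfold_exceptional_of_lev_eq_eight_forty (lev := (![8, 40] : Fin 2 → ℕ)) (A := A) rfl rfl hΦ hA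
  exact ⟨B 0, B 1, hs 0, hs 1, hd0, hd1, hB0, hB1, hu, hv, hnot, hdimP, hcP, hDP⟩

end Existence

end HyperellipticJacobian

end Literature.AlgebraicGeometry.ComplexMultiplication
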